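import Summits.RiemannHypothesis.RiemannHypothesis.Theorems.PfPersistenceGalerkinCutoffProfile
import HarnessLib

/-!
# The archimedean block of the cut-off Galerkin profile in closed (Markov) form

`mechanism/rigidity campaign; no RH claims`.

PROVED here (RH-free), for `f = cutoffProfile win v`, `ν = v ⬝ᵥ v`, `A = autocorr (2a) v`:

* linearity `v ⬝ᵥ (archBlock win · v) = W_R(2a; A)` (the `(n,m)` integrands `(θₙₘ e^{y/2} − θₙₘ(0))/sinh y`
  are separately integrable);
* FORM-DOMAIN MEMBERSHIP: `t ↦ ρ(t) D_t(f)` (`ρ = weilArchDensity`) is integrable on `(0, ∞)`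
  (`= e^{t/2}(ν − A(t))/sinh t` on `(0, 2a]`, `= 2ν ρ(t)` beyond);
* the tail `∫_{L}^∞ dt/sinh t = log(1 + e^{-L}) − log(1 − e^{-L})` and `κ_{2a} = γ + log 4π + log tanh a` unfolded;
* THE ARCHIMEDEAN IDENTITY
  `−v ⬝ᵥ (archBlock win · v) = ∫₀^∞ ρ D(f) − 2ν ∫₀^∞ (e^{t/2} − 1)/(2 sinh t) − (log 4π + γ) ν`,
  i.e. the archimedean part of the Markov closed form (`WeilMarkovQuadratic`).
-/

set_option linter.dupNamespace false

noncomputable section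

open Real intervalIntegral MeasureTheory Set Matrix Filter
open scoped Topology

namespace Summit.RiemannHypothesis.RiemannHypothesis.Theorems.PfPersistence

open Literature.NumberTheory.LFunctions

/-! ## 5. The archimedean block -/

section Arch

variable (win : Window) (v : Fin (win.N + 1) → ℝ)

/-- Linearity: `v ⬝ᵥ (archBlock win · v) = W_R(2a; A)` with `A = autocorr (2a) v` the windowed
autocorrelation (the `(n,m)` integrands are separately integrable: `θₙₘ e^{y/2} − θₙₘ(0) = O(y)`). -/
theorem archBlock_form_eq :
    v ⬝ᵥ (archBlock win *ᵥ v) = WR (2 * win.a) (autocorr (2 * win.a) v) := by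
  have ha := win.ha
  have hL : 0 < 2 * win.a := by positivity
  have hθint : ∀ n m : ℕ, IntegrableOn (fun y => (thetaEven (2 * win.a) n m y * Real.exp (y / 2) -
      thetaEven (2 * win.a) n m 0) / Real.sinh y) (Ioc 0 (2 * win.a)) := fun n m =>
    integrableOn_div_sinh_Ioc
      (((contDiff_thetaEven (2 * win.a) n m).mul (by fun_prop)).sub contDiff_const) (by simp) _
  have hF : ∀ n m : Fin (win.N + 1), IntervalIntegrable (fun y => v n *
      ((thetaEven (2 * win.a) n m y * Real.exp (y / 2) - thetaEven (2 * win.a) n m 0) / Real.sinh y) *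
      v m) volume 0 (2 * win.a) := fun n m =>
    (intervalIntegrable_iff_integrableOn_Ioc_of_le hL.le).2
      ((Integrable.const_mul (hθint n m) (v n)).mul_const (v m))
  have hFsum : ∀ n : Fin (win.N + 1), IntervalIntegrable (fun y => ∑ m : Fin (win.N + 1), v n *
      ((thetaEven (2 * win.a) n m y * Real.exp (y / 2) - thetaEven (2 * win.a) n m 0) / Real.sinh y) *
      v m) volume 0 (2 * win.a) := fun n =>
    (intervalIntegrable_iff_integrableOn_Ioc_of_le hL.le).2
      (integrable_finsetSum Finset.univ fun m _ =>
        (intervalIntegrable_iff_integrableOn_Ioc_of_le hL.le).1 (hF n m))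
  have hpt : ∀ y, ∑ n : Fin (win.N + 1), ∑ m : Fin (win.N + 1), v n *
      ((thetaEven (2 * win.a) n m y * Real.exp (y / 2) - thetaEven (2 * win.a) n m 0) / Real.sinh y) *
      v m = (autocorr (2 * win.a) v y * Real.exp (y / 2) - autocorr (2 * win.a) v 0) / Real.sinh y := by
    intro y
    rw [← sum_thetaEven_eq_autocorr hL v y, ← sum_thetaEven_eq_autocorr hL v 0, Finset.sum_mul,
      ← Finset.sum_sub_distrib, Finset.sum_div]
    refine Finset.sum_congr rfl fun n _ => ?_
    rw [Finset.sum_mul, ← Finset.sum_sub_distrib, Finset.sum_div]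
    refine Finset.sum_congr rfl fun m _ => ?_
    ring
  rw [dotProduct_mulVec_eq_sum]
  simp only [archBlock, WR]
  calc ∑ n : Fin (win.N + 1), ∑ m : Fin (win.N + 1), v n * (kappaL (2 * win.a) *
          thetaEven (2 * win.a) n m 0 + ∫ y in (0:ℝ)..2 * win.a, (thetaEven (2 * win.a) n m y *
          Real.exp (y / 2) - thetaEven (2 * win.a) n m 0) / Real.sinh y) * v m
      = kappaL (2 * win.a) * (∑ n : Fin (win.N + 1), ∑ m : Fin (win.N + 1),
          v n * thetaEven (2 * win.a) n m 0 * v m) +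
        ∑ n : Fin (win.N + 1), ∑ m : Fin (win.N + 1), ∫ y in (0:ℝ)..2 * win.a, v n *
          ((thetaEven (2 * win.a) n m y * Real.exp (y / 2) - thetaEven (2 * win.a) n m 0) /
            Real.sinh y) * v m := by
        rw [Finset.mul_sum, ← Finset.sum_add_distrib]
        refine Finset.sum_congr rfl fun n _ => ?_
        rw [Finset.mul_sum, ← Finset.sum_add_distrib]
        refine Finset.sum_congr rfl fun m _ => ?_
        rw [intervalIntegral.integral_mul_const, intervalIntegral.integral_const_mul]
        ring
    _ = kappaL (2 * win.a) * autocorr (2 * win.a) v 0 + ∫ y in (0:ℝ)..2 * win.a,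
          (autocorr (2 * win.a) v y * Real.exp (y / 2) - autocorr (2 * win.a) v 0) / Real.sinh y := by
        rw [sum_thetaEven_eq_autocorr hL v 0]
        congr 1
        simp_rw [← hpt]
        rw [intervalIntegral.integral_finsetSum (fun n _ => hFsum n)]
        refine Finset.sum_congr rfl fun n _ => ?_
        rw [intervalIntegral.integral_finsetSum (fun m _ => hF n m)]

/-- On `(0, 2a]`: `ρ(t) D_t(f) = e^{t/2}(ν − A(t))/sinh t`. -/
theorem archDensity_mul_increment_eq {t : ℝ} (ht0 : 0 < t) (ht : t ≤ 2 * win.a) :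
    weilArchDensity t * weilIncrement (cutoffProfile win v) t =
      Real.exp (t / 2) * (v ⬝ᵥ v - autocorr (2 * win.a) v t) / Real.sinh t := by
  rw [weilIncrement_cutoffProfile_of_le win v ht0.le ht, weilArchDensity]
  have hs : Real.sinh t ≠ 0 := (Real.sinh_pos_iff.2 ht0).ne'
  field_simp

/-- Beyond the window (`t ≥ 2a`): `ρ(t) D_t(f) = 2ν ρ(t)`. -/
theorem archDensity_mul_increment_eq_of_ge {t : ℝ} (ht : 2 * win.a ≤ t) :
    weilArchDensity t * weilIncrement (cutoffProfile win v) t =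
      weilArchDensity t * (2 * (v ⬝ᵥ v)) := by
  rw [weilIncrement_cutoffProfile_of_ge win v ht]

/-- The archimedean increment energy density of the cut-off profile is integrable on `(0, 2a]`. [folklore] -/
theorem integrableOn_archEnergy_Ioc :
    IntegrableOn (fun t => weilArchDensity t * weilIncrement (cutoffProfile win v) t)
      (Ioc 0 (2 * win.a)) := by
  have hL : 0 < 2 * win.a := by linarith [win.ha]
  have hh : ContDiff ℝ 1 (fun t => Real.exp (t / 2) * (v ⬝ᵥ v - autocorr (2 * win.a) v t)) :=
    (by fun_prop : ContDiff ℝ 1 fun t : ℝ => Real.exp (t / 2)).mul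
      (contDiff_const.sub (contDiff_autocorr hL v))
  have h0 : Real.exp (0 / 2) * (v ⬝ᵥ v - autocorr (2 * win.a) v 0) = 0 := by
    rw [autocorr_zero hL]; ring
  refine (integrableOn_div_sinh_Ioc hh h0 (2 * win.a)).congr_fun (fun t ht => ?_) measurableSet_Ioc
  exact (archDensity_mul_increment_eq win v ht.1 ht.2).symm

/-- The archimedean increment energy density of the cut-off profile is integrable on `(2a, ∞)`. [folklore] -/
theorem integrableOn_archEnergy_Ioi_two_mul :
    IntegrableOn (fun t => weilArchDensity t * weilIncrement (cutoffProfile win v) t)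
      (Ioi (2 * win.a)) := by
  have hL : 0 < 2 * win.a := by linarith [win.ha]
  refine IntegrableOn.congr_fun ((integrableOn_weilArchDensity_Ioi hL).mul_const (2 * (v ⬝ᵥ v)))
    (fun t ht => ?_) measurableSet_Ioi
  exact (archDensity_mul_increment_eq_of_ge win v (le_of_lt ht)).symm

/-- FORM-DOMAIN MEMBERSHIP of the cut-off profile: its archimedean increment energy is finite. -/
theorem integrableOn_archEnergy_cutoffProfile :
    IntegrableOn (fun t => weilArchDensity t * weilIncrement (cutoffProfile win v) t) (Ioi 0) := by
  have hL : 0 ≤ 2 * win.a := by linarith [win.ha]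
  rw [← Ioc_union_Ioi_eq_Ioi hL]
  exact (integrableOn_archEnergy_Ioc win v).union (integrableOn_archEnergy_Ioi_two_mul win v)

/-- The tail `∫_{L}^{∞} dt / sinh t = log(1 + e^{-L}) − log(1 − e^{-L})` (`= −log tanh(L/2)`), `L > 0`,
with integrability. -/
theorem integral_Ioi_inv_sinh {L : ℝ} (hL : 0 < L) :
    IntegrableOn (fun t => (Real.sinh t)⁻¹) (Ioi L) ∧
      ∫ t in Ioi L, (Real.sinh t)⁻¹ = Real.log (1 + Real.exp (-L)) - Real.log (1 - Real.exp (-L)) := by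
  set g : ℝ → ℝ := fun t => Real.log (1 - Real.exp (-t)) - Real.log (1 + Real.exp (-t)) with hg
  have hderiv : ∀ t, 0 < t → HasDerivAt g ((Real.sinh t)⁻¹) t := by
    intro t ht
    have hE1 : 0 < 1 - Real.exp (-t) := sub_pos.2 (Real.exp_lt_one_iff.2 (by linarith))
    have hE2 : 0 < 1 + Real.exp (-t) := by positivity
    have he : HasDerivAt (fun t => Real.exp (-t)) (Real.exp (-t) * -1) t := (hasDerivAt_neg t).exp
    have h1 : HasDerivAt (fun t => Real.log (1 - Real.exp (-t)))
        ((0 - Real.exp (-t) * -1) / (1 - Real.exp (-t))) t :=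
      ((hasDerivAt_const t (1:ℝ)).sub he).log hE1.ne'
    have h2 : HasDerivAt (fun t => Real.log (1 + Real.exp (-t)))
        ((0 + Real.exp (-t) * -1) / (1 + Real.exp (-t))) t :=
      ((hasDerivAt_const t (1:ℝ)).add he).log hE2.ne'
    have h : HasDerivAt g ((0 - Real.exp (-t) * -1) / (1 - Real.exp (-t)) -
        (0 + Real.exp (-t) * -1) / (1 + Real.exp (-t))) t := h1.sub h2
    have key : Real.exp (-t) / (1 - Real.exp (-t)) + Real.exp (-t) / (1 + Real.exp (-t)) =
        (Real.sinh t)⁻¹ := by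
      have hEe : Real.exp t * Real.exp (-t) = 1 := by
        rw [← Real.exp_add, add_neg_cancel, Real.exp_zero]
      have hden : Real.exp t - Real.exp (-t) ≠ 0 := by
        have hs : Real.sinh t ≠ 0 := (Real.sinh_pos_iff.2 ht).ne'
        rw [Real.sinh_eq] at hs
        intro h0; exact hs (by rw [h0, zero_div])
      rw [Real.sinh_eq, inv_div, div_add_div _ _ hE1.ne' hE2.ne',
        div_eq_div_iff (mul_ne_zero hE1.ne' hE2.ne') hden]
      linear_combination 2 * hEe
    refine h.congr_deriv ?_
    rw [← key]
    ring
  have hcont : ContinuousWithinAt g (Ici L) L := (hderiv L hL).continuousAt.continuousWithinAt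
  have hlim : Tendsto g atTop (𝓝 0) := by
    have h1 : Tendsto (fun t => Real.log (1 - Real.exp (-t))) atTop (𝓝 (Real.log (1 - 0))) :=
      (tendsto_const_nhds.sub Real.tendsto_exp_neg_atTop_nhds_zero).log (by norm_num)
    have h2 : Tendsto (fun t => Real.log (1 + Real.exp (-t))) atTop (𝓝 (Real.log (1 + 0))) :=
      (tendsto_const_nhds.add Real.tendsto_exp_neg_atTop_nhds_zero).log (by norm_num)
    have := h1.sub h2
    simpa using this
  have hnn : ∀ t ∈ Ioi L, 0 ≤ (Real.sinh t)⁻¹ := fun t ht =>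
    inv_nonneg.2 (Real.sinh_pos_iff.2 (hL.trans ht)).le
  refine ⟨integrableOn_Ioi_deriv_of_nonneg hcont (fun t ht => hderiv t (hL.trans ht)) hnn hlim, ?_⟩
  rw [integral_Ioi_of_hasDerivAt_of_nonneg hcont (fun t ht => hderiv t (hL.trans ht)) hnn hlim, hg]
  ring

/-- `κ_{2a} = γ + log 4π + log(1 − e^{-2a}) − log(1 + e^{-2a})` (`log tanh a` unfolded). -/
theorem kappaL_two_mul {a : ℝ} (ha : 0 < a) :
    kappaL (2 * a) = Real.eulerMascheroniConstant + Real.log (4 * π) +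
      (Real.log (1 - Real.exp (-(2 * a))) - Real.log (1 + Real.exp (-(2 * a)))) := by
  have hE1 : 0 < 1 - Real.exp (-(2 * a)) := sub_pos.2 (Real.exp_lt_one_iff.2 (by linarith))
  have hE2 : 0 < 1 + Real.exp (-(2 * a)) := by positivity
  have htanh : Real.tanh a = (1 - Real.exp (-(2 * a))) / (1 + Real.exp (-(2 * a))) := by
    rw [Real.tanh_eq_sinh_div_cosh, Real.sinh_eq, Real.cosh_eq,
      show -(2 * a) = -a + -a by ring, Real.exp_add, Real.exp_neg]
    have hexp : Real.exp a ≠ 0 := (Real.exp_pos a).ne'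
    field_simp
  have htanh_pos : 0 < Real.tanh a := by rw [htanh]; positivity
  unfold kappaL
  rw [show 2 * a / 2 = a by ring, Real.log_mul (by positivity) htanh_pos.ne', htanh,
    Real.log_div hE1.ne' hE2.ne']
  ring

/-- THE ARCHIMEDEAN IDENTITY: `−v ⬝ᵥ (archBlock win · v)` equals the archimedean part of the closed
form, `∫₀^∞ ρ D(f) − 2ν ∫₀^∞ (e^{t/2} − 1)/(2 sinh t) − (log 4π + γ) ν`. -/
theorem archBlock_form_eq_energy :
    -(v ⬝ᵥ (archBlock win *ᵥ v)) =
      (∫ t in Ioi (0:ℝ), weilArchDensity t * weilIncrement (cutoffProfile win v) t) -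
        2 * (v ⬝ᵥ v) * (∫ t in Ioi (0:ℝ), (Real.exp (t / 2) - 1) / (2 * Real.sinh t)) -
        (Real.log (4 * π) + Real.eulerMascheroniConstant) * (v ⬝ᵥ v) := by
  have ha := win.ha
  have hL : 0 < 2 * win.a := by positivity
  have hkI : IntegrableOn (fun t : ℝ => (Real.exp (t / 2) - 1) / (2 * Real.sinh t)) (Ioc 0 (2 * win.a)) :=
    integrableOn_weilKillingDensity.mono_set Ioc_subset_Ioi_self
  have hkT : IntegrableOn (fun t : ℝ => (Real.exp (t / 2) - 1) / (2 * Real.sinh t)) (Ioi (2 * win.a)) :=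
    integrableOn_weilKillingDensity.mono_set (Ioi_subset_Ioi hL.le)
  have hEI := integrableOn_archEnergy_Ioc win v
  have hET := integrableOn_archEnergy_Ioi_two_mul win v
  have hdisj : Disjoint (Ioc 0 (2 * win.a)) (Ioi (2 * win.a)) :=
    Set.disjoint_left.2 fun t ht ht' => not_lt.2 ht.2 ht'
  obtain ⟨hsI, hsv⟩ := integral_Ioi_inv_sinh hL
  -- the window piece
  have hpiece1 : (∫ t in Ioc 0 (2 * win.a), weilArchDensity t * weilIncrement (cutoffProfile win v) t) -
      2 * (v ⬝ᵥ v) * (∫ t in Ioc 0 (2 * win.a), (Real.exp (t / 2) - 1) / (2 * Real.sinh t)) =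
      -∫ y in (0:ℝ)..2 * win.a, (autocorr (2 * win.a) v y * Real.exp (y / 2) - v ⬝ᵥ v) /
        Real.sinh y := by
    rw [← MeasureTheory.integral_const_mul, ← integral_sub hEI (hkI.const_mul _),
      intervalIntegral.integral_of_le hL.le, ← MeasureTheory.integral_neg]
    refine setIntegral_congr_fun measurableSet_Ioc fun t ht => ?_
    rw [archDensity_mul_increment_eq win v ht.1 ht.2]
    have hs : Real.sinh t ≠ 0 := (Real.sinh_pos_iff.2 ht.1).ne'
    field_simp
    ring
  -- the tail piece
  have hpiece2 : (∫ t in Ioi (2 * win.a), weilArchDensity t * weilIncrement (cutoffProfile win v) t) -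
      2 * (v ⬝ᵥ v) * (∫ t in Ioi (2 * win.a), (Real.exp (t / 2) - 1) / (2 * Real.sinh t)) =
      (v ⬝ᵥ v) * (Real.log (1 + Real.exp (-(2 * win.a))) - Real.log (1 - Real.exp (-(2 * win.a)))) := by
    rw [← hsv, ← MeasureTheory.integral_const_mul, ← MeasureTheory.integral_const_mul,
      ← integral_sub hET (hkT.const_mul _)]
    refine setIntegral_congr_fun measurableSet_Ioi fun t ht => ?_
    have ht0 : 0 < t := hL.trans ht
    rw [archDensity_mul_increment_eq_of_ge win v (le_of_lt ht), weilArchDensity]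
    have hs : Real.sinh t ≠ 0 := (Real.sinh_pos_iff.2 ht0).ne'
    field_simp
    ring
  rw [archBlock_form_eq, WR, autocorr_zero hL, kappaL_two_mul ha,
    ← Ioc_union_Ioi_eq_Ioi hL.le, setIntegral_union hdisj measurableSet_Ioi hEI hET,
    setIntegral_union hdisj measurableSet_Ioi hkI hkT]
  linear_combination -hpiece1 - hpiece2

end Arch

end Summit.RiemannHypothesis.RiemannHypothesis.Theorems.PfPersistence
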